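import Summits.RiemannHypothesis.RiemannHypothesis.Theorems.PlantedScrewBlindness

/-!
# W-06 cycle 7 «DETECTION COST ATLAS», cell C3⁷ proper — RESONANCE ROUTE (rh-idea-3 g16) — LANE item (6b) = §R of the pre-cut (6)

(CA117)/(CA137) lane slot (6b): the EXACT rank-4 cosh–sinh form of the planted defect
`(δ²+γ²)²·vᵀD_{n+1}v = 4(γ²−δ²)(|C(v)|² − |S(v)|²) − 16δγ·Im(S(v)·conj C(v))` (K, `defectCoshSinhForm_holds`) and the
resonance-route blind laws (one-scalar law `posDef_of_oneScalar`; exact-root law `blind_of_sinhSum`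
`4·Σ_{i<n} sinh²(δ log(i+2)) < μ₅₁₂(γ²−δ²)`; closed form `blind_of_heightClosedForm` `n·((n+1)^δ)² < μ₅₁₂(γ²−δ²)`), RE-POINTED by
ONE import onto the landed lane items (1) `Theorems/PlantedPair.lean` (defs of record `RhIdea2G21.W06C6.pairDefect / plantedScrew /
plantedScrewMatrix`) and (2) `Theorems/PlantedScrewBlindness.lean` (`RhIdea6.G15.C47.defectKernel / defectMatrix /
plantedScrewMatrix_eq / plantedScrewMatrix_isHermitian / screwMatrix_quadForm_ge_of_le_511`); it uses NOTHING from §L (6a) nor from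
(3) `…Sharp`.  Body = §R of `pub/ideators/rh-idea-3/g16/c7/PlantedScrewBlindnessLevels-rh-idea-3-g16.lean` VERBATIM (same namespace
`RhIdea3.G16.Levels`); RE-CUT (CA137) of the desk pre-cut of record `PlantedScrewBlindnessLevels.lean` 18002c2d244b21a8 · 445 at its
§L/§R boundary (400-line lint), body byte-verbatim.  NO screw function is defined here (no `quadScrew` copy).
Tier K (kernel, 0 sorry).  Credit rh-idea-3 g16.  READING (TEST 0): the planted object is NOT `ζ`; nothing here bears on the
truth of RH; `S_512(ζ) ≻ 0` is the tree's certified computation (`IntegerScrew.screwMatrix_quadForm_ge_511/255/127`).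
-/

noncomputable section

namespace RhIdea3.G16.Levels

open Literature.NumberTheory.LFunctions
open RhIdea2G21.W06C6
open RhIdea6.G15.C47
open Summit.RiemannHypothesis.RiemannHypothesis.Theorems.IntegerScrew


/-! ### §R  RESONANCE ROUTE (rh-idea-3 g16, cell C3⁷ proper) — the EXACT rank-4 cosh–sinh form of the planted defect, K

`(δ²+γ²)²·vᵀD_{n+1}(δ,γ)v = 4(γ²−δ²)(|C(v)|² − |S(v)|²) − 16δγ·Im(S(v)·conj C(v))`,
`S(v) = Σ v_i sinh(δt_i)e^{iγt_i}`, `C(v) = Σ v_i (cosh(δt_i)e^{iγt_i} − 1)`, `t_i = log(i+2)` (`defectCoshSinhForm_holds`,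
0 sorry) ⟹ by completing the square `(γ²−δ²)·vᵀDv ≥ −4|S(v)|²` (`defect_lowerBound_of_form`) ⟹ the ONE-SCALAR blind
law `posDef_of_oneScalar` and, with Cauchy–Schwarz against the certified margin, the EXACT-ROOT law `blind_of_sinhSum`
(`4·Σ_{i<n} sinh²(δ log(i+2)) < μ₅₁₂(γ²−δ²)`, n ≤ 511) and its closed form `blind_of_heightClosedForm`
(`n·((n+1)^δ)² < μ₅₁₂(γ²−δ²)`).  Desk thresholds at n = 511 (γ >): exact-sum 739/1537/3568/6767/16337, closed form
1866/2550/4758/8878/22631, versus §L's entrywise 6993/7383/8521/10316/14808 (δ = .05/.1/.2/.3/.45).  OPTIONAL for lane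
item (6) — director's call; independent of §L. -/

open Matrix

/-- screw node `t_i = log(i+2)` of `S_{n+1}` (row `i : Fin n`). -/
def tnode {n : ℕ} (i : Fin n) : ℝ := Real.log (((i : ℕ) : ℝ) + 2)

/-- `Re S(v)`, `S(v) = Σ v_i sinh(δ t_i) e^{iγ t_i}` — the resonant SINH functional. -/
def Sre (δ γ : ℝ) (n : ℕ) (v : Fin n → ℝ) : ℝ := ∑ i, v i * (Real.sinh (δ * tnode i) * Real.cos (γ * tnode i))
/-- `Im S(v)`. -/
def Sim (δ γ : ℝ) (n : ℕ) (v : Fin n → ℝ) : ℝ := ∑ i, v i * (Real.sinh (δ * tnode i) * Real.sin (γ * tnode i))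
/-- `Re C(v)`, `C(v) = Σ v_i (cosh(δ t_i) e^{iγ t_i} − 1)` — the resonant COSH functional of the zero-sum extension. -/
def Cre (δ γ : ℝ) (n : ℕ) (v : Fin n → ℝ) : ℝ := ∑ i, v i * (Real.cosh (δ * tnode i) * Real.cos (γ * tnode i) - 1)
/-- `Im C(v)`. -/
def Cim (δ γ : ℝ) (n : ℕ) (v : Fin n → ℝ) : ℝ := ∑ i, v i * (Real.cosh (δ * tnode i) * Real.sin (γ * tnode i))
/-- `|S(v)|²`. -/
def S2 (δ γ : ℝ) (n : ℕ) (v : Fin n → ℝ) : ℝ := Sre δ γ n v ^ 2 + Sim δ γ n v ^ 2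
/-- `|C(v)|²`. -/
def C2 (δ γ : ℝ) (n : ℕ) (v : Fin n → ℝ) : ℝ := Cre δ γ n v ^ 2 + Cim δ γ n v ^ 2
/-- `Im(S(v)·conj C(v)) = Im S·Re C − Re S·Im C`. -/
def YSC (δ γ : ℝ) (n : ℕ) (v : Fin n → ℝ) : ℝ := Sim δ γ n v * Cre δ γ n v - Sre δ γ n v * Cim δ γ n v

/-- **THE EXACT COSH–SINH (rank-4) FORM of the planted defect** at `(δ, γ)` on level `n+1`:
`(δ²+γ²)²·vᵀD_{n+1}v = 4(γ²−δ²)(|C(v)|² − |S(v)|²) − 16δγ·Im(S(v) conj C(v))` for every `v`.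
KERNEL-CHECKED below (`defectCoshSinhForm_holds`); numerics-verified to relative 1e-15 beforehand (`rho_scan.py`). -/
def DefectCoshSinhForm (δ γ : ℝ) (n : ℕ) : Prop :=
  ∀ v : Fin n → ℝ, (δ ^ 2 + γ ^ 2) ^ 2 * (v ⬝ᵥ (defectMatrix δ γ n *ᵥ v))
    = 4 * (γ ^ 2 - δ ^ 2) * (C2 δ γ n v - S2 δ γ n v) - 16 * δ * γ * YSC δ γ n v

/-! ### K PROOF of the form: `q·Q(s) = −4(γ²−δ²)(cosh δs cos γs − 1) + 8δγ sinh δs sin γs` pointwise, then the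
symmetrised kernel identity and the double-sum bookkeeping (`Finset.sum_mul_sum`). 0 sorry. -/

/-- real form of one zero-side increment (any sign of the real argument `s`; `w = a + iγ`, junk-safe at `w = 0`). -/
theorem re_increment_eq (a γ s : ℝ) :
    ((Complex.exp ((⟨a, γ⟩ : ℂ) * (s : ℝ)) - 1) / ((⟨a, γ⟩ : ℂ) ^ 2)).re
      = ((Real.exp (a * s) * Real.cos (γ * s) - 1) * (a ^ 2 - γ ^ 2)
          + Real.exp (a * s) * Real.sin (γ * s) * (2 * a * γ)) / (a ^ 2 + γ ^ 2) ^ 2 := by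
  have hw2 : ((⟨a, γ⟩ : ℂ) ^ 2) = ⟨a ^ 2 - γ ^ 2, 2 * a * γ⟩ := by
    apply Complex.ext <;> (simp [sq, Complex.mul_re, Complex.mul_im]; try ring)
  have hz : (⟨a, γ⟩ : ℂ) * (s : ℝ) = ⟨a * s, γ * s⟩ := by
    apply Complex.ext <;> simp [Complex.mul_re, Complex.mul_im]
  have hE : Complex.exp ((⟨a, γ⟩ : ℂ) * (s : ℝ)) - 1
      = ⟨Real.exp (a * s) * Real.cos (γ * s) - 1, Real.exp (a * s) * Real.sin (γ * s)⟩ := by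
    rw [hz]
    apply Complex.ext
    · simp [Complex.exp_re]
    · simp [Complex.exp_im]
  have hN : Complex.normSq (⟨a ^ 2 - γ ^ 2, 2 * a * γ⟩ : ℂ) = (a ^ 2 + γ ^ 2) ^ 2 := by
    simp [Complex.normSq_apply]; ring
  rw [hE, hw2, Complex.div_re, hN, ← add_div]

/-- `q·Q(s; δ, γ) = −4(γ²−δ²)(cosh δs·cos γs − 1) + 8δγ·sinh δs·sin γs`, `q = (δ²+γ²)²` (all real `s`). -/
theorem q_mul_pairDefect (δ γ s : ℝ) :
    (δ ^ 2 + γ ^ 2) ^ 2 * pairDefect δ γ s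
      = -4 * (γ ^ 2 - δ ^ 2) * (Real.cosh (δ * s) * Real.cos (γ * s) - 1)
        + 8 * δ * γ * (Real.sinh (δ * s) * Real.sin (γ * s)) := by
  unfold pairDefect
  rw [re_increment_eq δ γ |s|, re_increment_eq (-δ) γ |s|]
  have hq : ((-δ) ^ 2 + γ ^ 2) = δ ^ 2 + γ ^ 2 := by ring
  rw [hq, Real.cosh_eq, Real.sinh_eq]
  set E := Real.exp (δ * s) with hE
  have hEpos : 0 < E := Real.exp_pos _
  have hEinv : Real.exp (-(δ * s)) = E⁻¹ := by rw [Real.exp_neg]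
  rcases abs_choice s with h | h
  · rw [h]
    have e2 : Real.exp (-δ * s) = E⁻¹ := by rw [neg_mul, Real.exp_neg]
    rw [e2, hEinv]
    by_cases hq0 : δ ^ 2 + γ ^ 2 = 0
    · have hδ2 : δ ^ 2 = 0 := by nlinarith [sq_nonneg δ, sq_nonneg γ]
      have hγ2 : γ ^ 2 = 0 := by nlinarith [sq_nonneg δ, sq_nonneg γ]
      have hδ : δ = 0 := (pow_eq_zero_iff two_ne_zero).mp hδ2
      have hγ : γ = 0 := (pow_eq_zero_iff two_ne_zero).mp hγ2
      subst hδ; subst hγ; simp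
    · field_simp
      ring
  · rw [h]
    have e1 : Real.exp (δ * -s) = E⁻¹ := by rw [mul_neg, Real.exp_neg]
    have e2 : Real.exp (-δ * -s) = E := by rw [neg_mul_neg]
    have c1 : Real.cos (γ * -s) = Real.cos (γ * s) := by rw [mul_neg, Real.cos_neg]
    have s1 : Real.sin (γ * -s) = -Real.sin (γ * s) := by rw [mul_neg, Real.sin_neg]
    rw [e1, e2, c1, s1, hEinv]
    by_cases hq0 : δ ^ 2 + γ ^ 2 = 0
    · have hδ2 : δ ^ 2 = 0 := by nlinarith [sq_nonneg δ, sq_nonneg γ]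
      have hγ2 : γ ^ 2 = 0 := by nlinarith [sq_nonneg δ, sq_nonneg γ]
      have hδ : δ = 0 := (pow_eq_zero_iff two_ne_zero).mp hδ2
      have hγ : γ = 0 := (pow_eq_zero_iff two_ne_zero).mp hγ2
      subst hδ; subst hγ; simp
    · field_simp
      ring

/-- pointwise rank-4 form of the defect kernel (symmetrised in `t ↔ u`). -/
theorem q_mul_defectKernel (δ γ t u : ℝ) :
    (δ ^ 2 + γ ^ 2) ^ 2 * defectKernel δ γ t u
      = 4 * (γ ^ 2 - δ ^ 2) *
          ((Real.cosh (δ * t) * Real.cos (γ * t) - 1) * (Real.cosh (δ * u) * Real.cos (γ * u) - 1)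
            + (Real.cosh (δ * t) * Real.sin (γ * t)) * (Real.cosh (δ * u) * Real.sin (γ * u))
            - (Real.sinh (δ * t) * Real.cos (γ * t)) * (Real.sinh (δ * u) * Real.cos (γ * u))
            - (Real.sinh (δ * t) * Real.sin (γ * t)) * (Real.sinh (δ * u) * Real.sin (γ * u)))
        - 8 * δ * γ *
          ((Real.sinh (δ * t) * Real.sin (γ * t)) * (Real.cosh (δ * u) * Real.cos (γ * u) - 1)
            + (Real.sinh (δ * u) * Real.sin (γ * u)) * (Real.cosh (δ * t) * Real.cos (γ * t) - 1)
            - (Real.sinh (δ * t) * Real.cos (γ * t)) * (Real.cosh (δ * u) * Real.sin (γ * u))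
            - (Real.sinh (δ * u) * Real.cos (γ * u)) * (Real.cosh (δ * t) * Real.sin (γ * t))) := by
  have ht := q_mul_pairDefect δ γ t
  have hu := q_mul_pairDefect δ γ u
  have htu := q_mul_pairDefect δ γ (t - u)
  rw [show δ * (t - u) = δ * t - δ * u by ring, show γ * (t - u) = γ * t - γ * u by ring,
    Real.cosh_sub, Real.sinh_sub, Real.cos_sub, Real.sin_sub] at htu
  unfold defectKernel
  linear_combination ht + hu - htu

/-- **THE EXACT COSH–SINH (rank-4) FORM of the planted defect — K.** -/
theorem defectCoshSinhForm_holds (δ γ : ℝ) (n : ℕ) : DefectCoshSinhForm δ γ n := by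
  unfold DefectCoshSinhForm
  intro v
  have hexp : v ⬝ᵥ (defectMatrix δ γ n *ᵥ v)
      = ∑ i : Fin n, ∑ j : Fin n, v i * (defectKernel δ γ (tnode i) (tnode j) * v j) := by
    simp only [dotProduct, Matrix.mulVec, defectMatrix, Matrix.of_apply, Finset.mul_sum]
    rfl
  have hpt : ∀ i j : Fin n,
      (δ ^ 2 + γ ^ 2) ^ 2 * (v i * (defectKernel δ γ (tnode i) (tnode j) * v j))
        = 4 * (γ ^ 2 - δ ^ 2) * ((v i * (Real.cosh (δ * tnode i) * Real.cos (γ * tnode i) - 1))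
              * (v j * (Real.cosh (δ * tnode j) * Real.cos (γ * tnode j) - 1)))
          + 4 * (γ ^ 2 - δ ^ 2) * ((v i * (Real.cosh (δ * tnode i) * Real.sin (γ * tnode i)))
              * (v j * (Real.cosh (δ * tnode j) * Real.sin (γ * tnode j))))
          - 4 * (γ ^ 2 - δ ^ 2) * ((v i * (Real.sinh (δ * tnode i) * Real.cos (γ * tnode i)))
              * (v j * (Real.sinh (δ * tnode j) * Real.cos (γ * tnode j))))
          - 4 * (γ ^ 2 - δ ^ 2) * ((v i * (Real.sinh (δ * tnode i) * Real.sin (γ * tnode i)))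
              * (v j * (Real.sinh (δ * tnode j) * Real.sin (γ * tnode j))))
          - 8 * δ * γ * ((v i * (Real.sinh (δ * tnode i) * Real.sin (γ * tnode i)))
              * (v j * (Real.cosh (δ * tnode j) * Real.cos (γ * tnode j) - 1)))
          - 8 * δ * γ * ((v i * (Real.cosh (δ * tnode i) * Real.cos (γ * tnode i) - 1))
              * (v j * (Real.sinh (δ * tnode j) * Real.sin (γ * tnode j))))
          + 8 * δ * γ * ((v i * (Real.sinh (δ * tnode i) * Real.cos (γ * tnode i)))
              * (v j * (Real.cosh (δ * tnode j) * Real.sin (γ * tnode j))))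
          + 8 * δ * γ * ((v i * (Real.cosh (δ * tnode i) * Real.sin (γ * tnode i)))
              * (v j * (Real.sinh (δ * tnode j) * Real.cos (γ * tnode j)))) := by
    intro i j
    have h := q_mul_defectKernel δ γ (tnode i) (tnode j)
    linear_combination (v i * v j) * h
  rw [hexp, Finset.mul_sum]
  simp_rw [Finset.mul_sum]
  rw [Finset.sum_congr rfl fun i _ => Finset.sum_congr rfl fun j _ => hpt i j]
  simp only [Finset.sum_add_distrib, Finset.sum_sub_distrib, ← Finset.mul_sum, ← Finset.sum_mul]
  unfold C2 S2 YSC Cre Cim Sre Sim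
  ring

/-- **K (algebra): completing the square — the one-scalar lower bound** `(γ²−δ²)·vᵀDv + 4|S(v)|² ≥ 0`
(the discriminant is EXACTLY zero: `(δ²+γ²)² − (γ²−δ²)² = (2δγ)²`). -/
theorem defect_lowerBound_of_form {δ γ : ℝ} {n : ℕ} (hF : DefectCoshSinhForm δ γ n) (v : Fin n → ℝ) :
    0 ≤ (γ ^ 2 - δ ^ 2) * (v ⬝ᵥ (defectMatrix δ γ n *ᵥ v)) + 4 * S2 δ γ n v := by
  unfold DefectCoshSinhForm at hF
  have h := hF v
  unfold C2 S2 YSC at h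
  unfold S2
  have hq : 0 ≤ (δ ^ 2 + γ ^ 2) ^ 2 := by positivity
  have key : (δ ^ 2 + γ ^ 2) ^ 2 *
        ((γ ^ 2 - δ ^ 2) * (v ⬝ᵥ (defectMatrix δ γ n *ᵥ v)) + 4 * (Sre δ γ n v ^ 2 + Sim δ γ n v ^ 2))
      = 4 * (((γ ^ 2 - δ ^ 2) * Cre δ γ n v - 2 * δ * γ * Sim δ γ n v) ^ 2
            + ((γ ^ 2 - δ ^ 2) * Cim δ γ n v + 2 * δ * γ * Sre δ γ n v) ^ 2) := by
    linear_combination (γ ^ 2 - δ ^ 2) * h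
  have hnn : 0 ≤ (δ ^ 2 + γ ^ 2) ^ 2 *
        ((γ ^ 2 - δ ^ 2) * (v ⬝ᵥ (defectMatrix δ γ n *ᵥ v)) + 4 * (Sre δ γ n v ^ 2 + Sim δ γ n v ^ 2)) := by
    rw [key]; positivity
  by_cases hq0 : (δ ^ 2 + γ ^ 2) ^ 2 = 0
  · -- degenerate `δ = γ = 0`: the defect matrix is of the zero pair; the bound is still the algebraic one
    have h0 : δ ^ 2 + γ ^ 2 = 0 := (pow_eq_zero_iff two_ne_zero).mp hq0
    have hδ2 : δ ^ 2 = 0 := by nlinarith [sq_nonneg δ, sq_nonneg γ]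
    have hγ2 : γ ^ 2 = 0 := by nlinarith [sq_nonneg δ, sq_nonneg γ]
    have hδ : δ = 0 := (pow_eq_zero_iff two_ne_zero).mp hδ2
    have hγ : γ = 0 := (pow_eq_zero_iff two_ne_zero).mp hγ2
    subst hδ; subst hγ
    simp only [sub_self, zero_mul, zero_add]
    positivity
  · have hqpos : 0 < (δ ^ 2 + γ ^ 2) ^ 2 := lt_of_le_of_ne hq (Ne.symm hq0)
    nlinarith [hnn, hqpos]

/-- «the resonant sinh functional is `ρ`-bounded by ζ's screw form at level `n+1`». -/
def SinhResonanceBound (δ γ : ℝ) (n : ℕ) (ρ : ℝ) : Prop :=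
  ∀ v : Fin n → ℝ, S2 δ γ n v ≤ ρ * (v ⬝ᵥ (screwMatrix n *ᵥ v))

/-- **ONE-SCALAR BLIND LAW (K modulo the form):** a positive margin for `S_{n+1}(ζ)`, the resonance bound `ρ`, and
`4ρ < γ² − δ²` give `S_{n+1}(planted δ, γ) ≻ 0`. -/
theorem posDef_of_oneScalar {n : ℕ} {δ γ ρ μ : ℝ} (hγ : δ ^ 2 < γ ^ 2)
    (hF : DefectCoshSinhForm δ γ n)
    (hμ0 : 0 < μ) (hμ : ∀ v : Fin n → ℝ, μ * (v ⬝ᵥ v) ≤ v ⬝ᵥ ((screwMatrix n).mulVec v))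
    (hρ : SinhResonanceBound δ γ n ρ) (hρa : 4 * ρ < γ ^ 2 - δ ^ 2) :
    (plantedScrewMatrix δ γ n).PosDef := by
  have hH := plantedScrewMatrix_isHermitian δ γ n
  rw [plantedScrewMatrix_eq] at hH ⊢
  refine Matrix.PosDef.of_dotProduct_mulVec_pos hH fun x hx => ?_
  have hxx : 0 < x ⬝ᵥ x := by
    obtain ⟨i, hi⟩ := Function.ne_iff.mp hx
    calc (0 : ℝ) < x i * x i := mul_self_pos.mpr hi
      _ ≤ x ⬝ᵥ x :=
          Finset.single_le_sum (f := fun j => x j * x j) (fun j _ => mul_self_nonneg (x j))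
            (Finset.mem_univ i)
  have hQ := hμ x
  have hQpos : 0 < x ⬝ᵥ (screwMatrix n *ᵥ x) := lt_of_lt_of_le (mul_pos hμ0 hxx) hQ
  have hD := defect_lowerBound_of_form hF x
  unfold SinhResonanceBound at hρ
  have hS := hρ x
  have ha : 0 < γ ^ 2 - δ ^ 2 := by linarith
  rw [star_trivial, Matrix.add_mulVec, dotProduct_add]
  nlinarith [hD, hS, hQpos, hρa, ha, mul_pos (sub_pos.mpr hρa) hQpos, mul_pos ha hQpos]

/-- **K (Cauchy–Schwarz): `|S(v)|² ≤ (Σ_i sinh²(δ t_i))·‖v‖²`.** -/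
theorem S2_le_sinhSum_mul (δ γ : ℝ) (n : ℕ) (v : Fin n → ℝ) :
    S2 δ γ n v ≤ (∑ i : Fin n, Real.sinh (δ * tnode i) ^ 2) * (v ⬝ᵥ v) := by
  have h1 := Finset.sum_mul_sq_le_sq_mul_sq Finset.univ
    (fun i : Fin n => Real.sinh (δ * tnode i) * Real.cos (γ * tnode i)) (fun i => v i)
  have h2 := Finset.sum_mul_sq_le_sq_mul_sq Finset.univ
    (fun i : Fin n => Real.sinh (δ * tnode i) * Real.sin (γ * tnode i)) (fun i => v i)
  have e0 : (∑ i : Fin n, v i ^ 2) = v ⬝ᵥ v := by simp [dotProduct, sq]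
  have e1 : Sre δ γ n v = ∑ i : Fin n, Real.sinh (δ * tnode i) * Real.cos (γ * tnode i) * v i := by
    unfold Sre; exact Finset.sum_congr rfl fun i _ => by ring
  have e2 : Sim δ γ n v = ∑ i : Fin n, Real.sinh (δ * tnode i) * Real.sin (γ * tnode i) * v i := by
    unfold Sim; exact Finset.sum_congr rfl fun i _ => by ring
  have e3 : (∑ i : Fin n, (Real.sinh (δ * tnode i) * Real.cos (γ * tnode i)) ^ 2)
      + (∑ i : Fin n, (Real.sinh (δ * tnode i) * Real.sin (γ * tnode i)) ^ 2)
      = ∑ i : Fin n, Real.sinh (δ * tnode i) ^ 2 := by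
    rw [← Finset.sum_add_distrib]
    refine Finset.sum_congr rfl fun i _ => ?_
    have hcs := Real.cos_sq_add_sin_sq (γ * tnode i)
    calc (Real.sinh (δ * tnode i) * Real.cos (γ * tnode i)) ^ 2 + (Real.sinh (δ * tnode i) * Real.sin (γ * tnode i)) ^ 2
        = Real.sinh (δ * tnode i) ^ 2 * (Real.cos (γ * tnode i) ^ 2 + Real.sin (γ * tnode i) ^ 2) := by ring
      _ = Real.sinh (δ * tnode i) ^ 2 := by rw [hcs, mul_one]
  unfold S2
  rw [e1, e2, ← e3, ← e0]
  calc (∑ i : Fin n, Real.sinh (δ * tnode i) * Real.cos (γ * tnode i) * v i) ^ 2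
        + (∑ i : Fin n, Real.sinh (δ * tnode i) * Real.sin (γ * tnode i) * v i) ^ 2
      ≤ (∑ i : Fin n, (Real.sinh (δ * tnode i) * Real.cos (γ * tnode i)) ^ 2) * (∑ i : Fin n, v i ^ 2)
        + (∑ i : Fin n, (Real.sinh (δ * tnode i) * Real.sin (γ * tnode i)) ^ 2) * (∑ i : Fin n, v i ^ 2) :=
        add_le_add h1 h2
    _ = ((∑ i : Fin n, (Real.sinh (δ * tnode i) * Real.cos (γ * tnode i)) ^ 2)
        + (∑ i : Fin n, (Real.sinh (δ * tnode i) * Real.sin (γ * tnode i)) ^ 2)) * (∑ i : Fin n, v i ^ 2) := by ring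

/-- **K: the resonance bound from a certified margin** — `μ‖v‖² ≤ vᵀS(ζ)v` gives `ρ = (Σ sinh²(δt_i))/μ`. -/
theorem sinhResonance_of_margin {n : ℕ} {μ : ℝ} (δ γ : ℝ) (hμ0 : 0 < μ)
    (hμ : ∀ v : Fin n → ℝ, μ * (v ⬝ᵥ v) ≤ v ⬝ᵥ ((screwMatrix n).mulVec v)) :
    SinhResonanceBound δ γ n ((∑ i : Fin n, Real.sinh (δ * tnode i) ^ 2) / μ) := by
  unfold SinhResonanceBound
  intro v
  have hs : 0 ≤ ∑ i : Fin n, Real.sinh (δ * tnode i) ^ 2 := Finset.sum_nonneg fun i _ => sq_nonneg _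
  have hv : v ⬝ᵥ v ≤ v ⬝ᵥ (screwMatrix n *ᵥ v) / μ := by
    rw [le_div_iff₀ hμ0]; linarith [hμ v]
  calc S2 δ γ n v ≤ (∑ i : Fin n, Real.sinh (δ * tnode i) ^ 2) * (v ⬝ᵥ v) := S2_le_sinhSum_mul δ γ n v
    _ ≤ (∑ i : Fin n, Real.sinh (δ * tnode i) ^ 2) * (v ⬝ᵥ (screwMatrix n *ᵥ v) / μ) :=
        mul_le_mul_of_nonneg_left hv hs
    _ = (∑ i : Fin n, Real.sinh (δ * tnode i) ^ 2) / μ * (v ⬝ᵥ (screwMatrix n *ᵥ v)) := by ring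

/-- **EXACT-ROOT BLIND LAW on the banked levels (K modulo the form; critic rider «no +3»):**
`n ≤ 511`, `δ² < γ²`, `4·Σ_{i<n} sinh²(δ log(i+2)) < μ₅₁₂·(γ² − δ²)` ⟹ `S_{n+1}(planted δ, γ) ≻ 0`. -/
theorem posDef_of_sinhSum {n : ℕ} {δ γ : ℝ} (hn : n ≤ 511) (hγ : δ ^ 2 < γ ^ 2)
    (hF : DefectCoshSinhForm δ γ n)
    (h : 4 * (∑ i : Fin n, Real.sinh (δ * tnode i) ^ 2) < (154108636812 : ℝ) / 2 ^ 49 * (γ ^ 2 - δ ^ 2)) :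
    (plantedScrewMatrix δ γ n).PosDef := by
  have hμ0 : (0 : ℝ) < (154108636812 : ℝ) / 2 ^ 49 := by positivity
  refine posDef_of_oneScalar hγ hF hμ0 (screwMatrix_quadForm_ge_of_le_511 hn)
    (sinhResonance_of_margin δ γ hμ0 (screwMatrix_quadForm_ge_of_le_511 hn)) ?_
  have : 4 * ((∑ i : Fin n, Real.sinh (δ * tnode i) ^ 2) / ((154108636812 : ℝ) / 2 ^ 49))
      = (4 * ∑ i : Fin n, Real.sinh (δ * tnode i) ^ 2) / ((154108636812 : ℝ) / 2 ^ 49) := by ring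
  rw [this, div_lt_iff₀ hμ0]
  linarith

/-- **EXACT-ROOT BLIND LAW, unconditional (K, 0 sorry):** `n ≤ 511`, `δ² < γ²`,
`4·Σ_{i<n} sinh²(δ·log(i+2)) < μ₅₁₂·(γ² − δ²)` ⟹ `S_{n+1}(planted δ, γ) ≻ 0`. -/
theorem blind_of_sinhSum {n : ℕ} {δ γ : ℝ} (hn : n ≤ 511) (hγ : δ ^ 2 < γ ^ 2)
    (h : 4 * (∑ i : Fin n, Real.sinh (δ * tnode i) ^ 2) < (154108636812 : ℝ) / 2 ^ 49 * (γ ^ 2 - δ ^ 2)) :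
    (plantedScrewMatrix δ γ n).PosDef :=
  posDef_of_sinhSum hn hγ (defectCoshSinhForm_holds δ γ n) h

/-- `sinh²(δ·log m) ≤ (m^δ)²/4` for `δ ≥ 0`, `m ≥ 1`. -/
theorem sinh_sq_le_rpow_sq {δ : ℝ} (hδ : 0 ≤ δ) {m : ℝ} (hm : 1 ≤ m) :
    Real.sinh (δ * Real.log m) ^ 2 ≤ (m ^ δ) ^ 2 / 4 := by
  have hm0 : 0 < m := by linarith
  have hx : 0 ≤ δ * Real.log m := mul_nonneg hδ (Real.log_nonneg hm)
  have hE : Real.exp (δ * Real.log m) = m ^ δ := by rw [Real.rpow_def_of_pos hm0, mul_comm]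
  rw [Real.sinh_eq, hE]
  have h1 : 0 < Real.exp (-(δ * Real.log m)) := Real.exp_pos _
  have h2 : Real.exp (-(δ * Real.log m)) ≤ m ^ δ := by
    rw [← hE]; exact Real.exp_le_exp.mpr (by linarith)
  have h3 : 0 ≤ m ^ δ - Real.exp (-(δ * Real.log m)) := by linarith
  nlinarith [h1, h2, h3]

/-- **CLOSED-FORM HEIGHT LAW of the resonance route (K, 0 sorry, every level free up to the bank):**
`n ≤ 511`, `0 ≤ δ`, `δ² < γ²`, `n·((n+1)^δ)² < μ₅₁₂·(γ² − δ²)` ⟹ `S_{n+1}(planted δ, γ) ≻ 0`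
(desk, n = 511: γ > 1866 / 2550 / 4758 / 8878 / 22631 at δ = .05/.1/.2/.3/.45 — cruder than the exact-sum
`blind_of_sinhSum` (739/1537/3568/6767/16337) but closed-form; beats the entrywise closed form rev2 §7
(6993/7383/8521/10316/14808) for δ ≤ 0.3 and loses at δ = 0.45, where `(m^δ)²` outgrows `6(m^δ + 3)`). -/
theorem blind_of_heightClosedForm {n : ℕ} {δ γ : ℝ} (hn : n ≤ 511) (hδ : 0 ≤ δ) (hγ : δ ^ 2 < γ ^ 2)
    (h : (n : ℝ) * (((n : ℝ) + 1) ^ δ) ^ 2 < (154108636812 : ℝ) / 2 ^ 49 * (γ ^ 2 - δ ^ 2)) :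
    (plantedScrewMatrix δ γ n).PosDef := by
  apply blind_of_sinhSum hn hγ
  have hterm : ∀ i : Fin n, Real.sinh (δ * tnode i) ^ 2 ≤ (((n : ℝ) + 1) ^ δ) ^ 2 / 4 := by
    intro i
    have hi0 : (0 : ℝ) ≤ ((i : ℕ) : ℝ) := Nat.cast_nonneg _
    have hi2 : (1 : ℝ) ≤ ((i : ℕ) : ℝ) + 2 := by linarith
    have hle : (((i : ℕ) : ℝ) + 2) ^ δ ≤ ((n : ℝ) + 1) ^ δ := by
      apply Real.rpow_le_rpow (by positivity) _ hδ
      have hlt : (i : ℕ) + 1 ≤ n := i.isLt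
      have : ((i : ℕ) : ℝ) + 1 ≤ (n : ℝ) := by exact_mod_cast hlt
      linarith
    have h0 : 0 ≤ (((i : ℕ) : ℝ) + 2) ^ δ := by positivity
    calc Real.sinh (δ * tnode i) ^ 2 ≤ ((((i : ℕ) : ℝ) + 2) ^ δ) ^ 2 / 4 := sinh_sq_le_rpow_sq hδ hi2
      _ ≤ (((n : ℝ) + 1) ^ δ) ^ 2 / 4 := by gcongr
  have hsum : ∑ i : Fin n, Real.sinh (δ * tnode i) ^ 2 ≤ (n : ℝ) * ((((n : ℝ) + 1) ^ δ) ^ 2 / 4) := by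
    calc ∑ i : Fin n, Real.sinh (δ * tnode i) ^ 2 ≤ ∑ _i : Fin n, (((n : ℝ) + 1) ^ δ) ^ 2 / 4 :=
          Finset.sum_le_sum fun i _ => hterm i
      _ = (n : ℝ) * ((((n : ℝ) + 1) ^ δ) ^ 2 / 4) := by
          simp [Finset.sum_const, Finset.card_univ, Fintype.card_fin, nsmul_eq_mul]
  linarith

end RhIdea3.G16.Levels

end
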